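import Summits.QuantumFields.GaugeBoot.Rows.KZL2rpD4CapWitB
import HarnessLib

/-!
# Gauge-boot / YM instrument: kernel cap checks of the kz-L2-rp-4D labels, chunks `52 … 55` (columns `5200 … 5599`)

Cell `ym-instrument` (HOME `run/shared/lean/pub/ym-instrument/`), crew (a), seat `ym-instrument-boot-lean-1`; A-plan-11 «BESSEL CAP»
per-label binding for the kz-L2-rp-4D label set (10 878 variables; `KZL2rpD4.label`). Witness lists from boot-plan g6's
`capwit/1` emission (kit j266067, desk `ym-instrument-boot-plan/capwit/capwit-kzL2_D4_b11o5_max_rp_hkhd_LIMcap_G2.json`, sha256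
`760379a4…`; identical records for b9o5), packed 100 witnesses of 80 bits per numeral by the seat script `work/capwit/gen.py`.

HONEST FRAMING (page 1 of every file of this cell): combinatorial DATA (link lists) and kernel checks of `GaugeBoot.capCheck`;
no bound is certified here and nothing is summit-bearing; the boxes `|y_v| ≤ ρ^{m(v)}` follow in
`YangMills/Theorems/Instrument/BesselCapBoxesKZL2rp.lean` from `BesselCapRows.cap_b*_of_capCheck`.

Each theorem: for 100 consecutive columns `v`, `GaugeBoot.capCheck (labelN v) (capWitN v) 12 = true` by `decide +kernel`
(the witness list is read exactly once by the label word on `ℤ⁴`, pairwise no common plaquette, spread `+ 3 ≤ 12`).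
-/

namespace Summit.QuantumFields.GaugeBoot

namespace KZL2rpD4

/-- The cap witnesses of columns `5200 … 5299` pass `capCheck` with threshold `L₀ = 12` (kernel). [folklore] -/
theorem capCheck_chunk_52 : ∀ r < 100, capCheck (labelN (100 * 52 + r)) (capWitN (100 * 52 + r)) 12 = true := by
  decide +kernel

/-- The cap witnesses of columns `5300 … 5399` pass `capCheck` with threshold `L₀ = 12` (kernel). [folklore] -/
theorem capCheck_chunk_53 : ∀ r < 100, capCheck (labelN (100 * 53 + r)) (capWitN (100 * 53 + r)) 12 = true := by
  decide +kernel

/-- The cap witnesses of columns `5400 … 5499` pass `capCheck` with threshold `L₀ = 12` (kernel). [folklore] -/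
theorem capCheck_chunk_54 : ∀ r < 100, capCheck (labelN (100 * 54 + r)) (capWitN (100 * 54 + r)) 12 = true := by
  decide +kernel

/-- The cap witnesses of columns `5500 … 5599` pass `capCheck` with threshold `L₀ = 12` (kernel). [folklore] -/
theorem capCheck_chunk_55 : ∀ r < 100, capCheck (labelN (100 * 55 + r)) (capWitN (100 * 55 + r)) 12 = true := by
  decide +kernel

end KZL2rpD4

end Summit.QuantumFields.GaugeBoot
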